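import Literature.MathematicalPhysics.QuantumFieldTheory.Balaban1983to89.B6RandomWalk

/-!
# `Balaban1983to89.B13EntrywiseBlockNumerals` — T. Bałaban, *Renormalization group approach to lattice gauge field theories. I.
Generation of effective actions in a small field approximation and a coupling constant renormalization in four dimensions*,
Commun. Math. Phys. **109** (1987) 249–301 [Balaban1987RG1], (1.11)–(1.14) p. 262; *II. Cluster expansions*, Commun. Math. Phys.
**116** (1988) 1–22 [Balaban1988RG2Cluster], p. 15, (2.16) p. 16, (2.24) p. 17; T. Bałaban, *Propagators and renormalization
transformations for lattice gauge theories. II*, Commun. Math. Phys. **96** (1984) 223–250 [Balaban1984PropagatorsII], Lemma 2.1 (2.61) p. 234: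
**THE (1.11)-NUMERICS AND THE JUNCTION-RATE CHAIN OF THE ENTRYWISE NODE-A BLOCK AS LOCATED NUMERALS** — the existential rates
`εΔ κΔ` (and the dials `ηΔ μΔ`) and the ELEVEN coupling hypotheses
`hηΔ hηε hρε hP2 hμΔ hμε hμκ hκεΔ hεP hkapP hKP` of the entrywise N10 junction (`Summits/…/BalabanUVNodesN10AtRecord11B13WalksBlockEntrywise`
= module 32 :≈250–258; at NODE 00's decorated kernel tower `…/BalabanUVNodesN10B13KernelTowerWalksEntrywiseNumeralsDecorated` = module 67
:218–227) ELIMINATED, in their exact binder shapes, into ONE RATE BUDGET and ONE CONSTANT FLOOR of the honest letters.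

statement-level skeleton of published theorems with citation tags; proofs where landed; nothing here is a claim about the
Yang–Mills mass gap

CITATION HEADER.  [Balaban1987RG1] p. 262, (1.11)–(1.14): the localized terms of the effective action decay exponentially in the
localization domains with a rate governed by the propagators' decay (the constants `κ`, `δ₀`, `M₁` of the inductive description);
[Balaban1988RG2Cluster] p. 15 (the kernels of the terms of the cluster expansion «have the same analyticity and decay properties»),
(2.16) p. 16 (exponential decay of the new terms with a SMALLER rate), p. 17 after (2.24) («Of course we have assumed that α₅ is
sufficiently small»), p. 21 closing paragraph («The assumptions allow finally us to fix all the constants, or rather bounds on these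
constants.»); [Balaban1984PropagatorsII] Lemma 2.1 (2.61) p. 234 (the row-sum constant `c₀` of an exponentially decaying kernel — every
product of decaying kernels loses a fraction of the rate and pays a factor `c₀` per junction).  NOT PRINTED: the explicit budget and
floor below — print chooses «suitable» rates at each step; the numerals are this file's bookkeeping of WHAT the choice has to satisfy for
the binders AS TYPED in the tree.

WHY THIS FILE (cell `pub-ymgap`, HUMAN RULING D-0062 Track A ∕ D-0149 width seats, node N10 = [B13], seat `pub-ymgap-dag-n10-w3` g2; the
lane owner's census `HOME/pub-ymgap-dag-n10-c/N10-RESIDUAL-CENSUS-v15.md`, class «★ NODE A about the record's own fields», sub-block «the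
(1.11) numerics, a junction rate, the letter match with `rf`»).  In the junction of record (module 67, theorem
`b13LeafOfRecord_layer_of_located_entrywise_numerals_decorated`) the binders
`{ρΔ BΔ εΔ κΔ ηΔ μΔ M₁ rC : ℝ} {mF c₀ : ℕ} … (hηΔ : 0 < ηΔ) (hηε : ηΔ ≤ εΔ) (hρε : εΔ < ρΔ) (hP2 : 2 * cp.κ₁ ≤ ηΔ * M₁) … (hμΔ : 0 < μΔ)
(hμε : 2 * μΔ ≤ εΔ - ηΔ) (hμκ : 2 * μΔ ≤ κΔ) (hκεΔ : κΔ ≤ ρΔ - εΔ) (hεP : rf.εP ≤ εΔ - ηΔ - μΔ - μΔ) (hkapP : rf.kapP ≤ κΔ - μΔ - μΔ)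
(hKP : (mF * B6.c0 1 μΔ ^ ν) * (…) * … ≤ rf.KbarP)` couple NODE A's letters — the decay rate `ρΔ` and constant `BΔ` of the σ-free fluctuation
operator's entries (`hEL`), the decoration's `c₀, M₁` (`hGJ`), the averaging range `rC` (`hCsupp`), the fibre bound `mF`, the record's
`κ₁` — with the rung's precision letters `rf.εP`, `rf.kapP`, `rf.KbarP` through TWO existential rates `εΔ` (far rate), `κΔ` (exchange
rate) and TWO dials `ηΔ` (decoration rate), `μΔ` (junction loss).  In print this is one sentence per step («with a smaller rate»,
«suitable constants»).  This file makes it a located numeral — pure real arithmetic over ABSTRACT real letters, no tree object — so that the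
lane's corollary edition of 67 instantiates it by `ν := lamD.toC.toK.ν`, `κ₁ := cp.κ₁`, `εP := rf.εP`, `kapP := rf.kapP`, `KbarP := rf.KbarP`
(`0 ≤ rf.εP`, `0 < rf.kapP` are `hrf.hεP`, `hrf.hkapP`).  Companion located numerals on the other NODE-A classes: `B13Bound226Numerals`
(n10-w1: `θ₀max ∕ γ₂max ∕ M⁴min`), `B13InverseLettersNeumannRadius` (n10-w2: the thin radius `R₁⋆` of an inverse factor),
`B13CondTowerAccretiveFloor` (n10-w4: the accretivity floor `m⋆`); the A6 joint witness of the whole block at a toy is n10-w2's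
`B13EntrywiseBlockWitness.entrywiseBlock_joint_nonvacuous`.

THE REDUCTION (§1–§2, dials `ηΔ μΔ` free).  With `εΔ := epsOf ηΔ εP μΔ := ηΔ + εP + 2μΔ` and `κΔ := kapOf kapP μΔ := kapP + 2μΔ` the SEVEN
rate binders `hηε hρε hμε hμκ hκεΔ hεP hkapP` ALL follow from `0 ≤ εP`, `0 ≤ kapP`, `0 < μΔ` and the ONE RATE BUDGET
`ηΔ + εP + kapP + 4μΔ ≤ ρΔ` (`rates_of_budget`, `exists_rates_of_budget`) — and CONVERSELY any `εΔ κΔ` satisfying `hμε hκεΔ hεP hkapP` force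
the budget (`budget_of_rates`): the elimination is LOSSLESS.  The constant binder `hKP` does not see `εΔ κΔ`; its left side is the numeral
`kbarFloor ν mF c₀ ρΔ ηΔ μΔ rC κ₁ BΔ` VERBATIM (§4), so at the dials the ELEVEN binders are: `0 < ηΔ`, `2κ₁ ≤ ηΔM₁`, `0 < μΔ`, the budget, and
`kbarFloor … ≤ KbarP` (`numerals_nodeA_of_dials`, §5).
THE CANONICAL DIALS (§3, §5).  `ηΔ := etaOf κ₁ M₁ := 2κ₁∕M₁` (the least decoration rate `hP2` admits; `0 < κ₁`, `0 < M₁`) and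
`μΔ := muOf ρΔ ηΔ εP kapP := (ρΔ − ηΔ − εP − kapP)∕4` (the junction loss EXHAUSTING the budget): then the eleven binders collapse to TWO
located inequalities — the STRICT budget `2κ₁∕M₁ + εP + kapP < ρΔ` («the decoration rate, the far rate and the exchange rate fit under the
fluctuation operator's decay rate») and the floor `kbarFloor ν mF c₀ ρΔ (etaOf κ₁ M₁) (muOf …) rC κ₁ BΔ ≤ KbarP` (`numerals_nodeA`).  HONEST
REMARK: the dials trade the floor against the budget (a larger `ηΔ` lowers `e^{(ρΔ−ηΔ)r_C}` in the floor but eats budget; a larger `μΔ` lowers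
`c₀(1,μΔ)` and `e^{−μΔ r_C}` likewise) — the canonical choice is ONE admissible choice, the dial form keeps every other.
§6: the located conditions are jointly inhabited with room (`exists_letters`, the A6 rule).
WHAT REMAINS DISPLAYED at the junction after this file: `0 < cp.κ₁`, `0 < M₁`, the strict budget `2cp.κ₁∕M₁ + rf.εP + rf.kapP < ρΔ` and the
floor `kbarFloor … ≤ rf.KbarP` (or, in dial form, `0 < ηΔ`, `2cp.κ₁ ≤ ηΔM₁`, `0 < μΔ`, `ηΔ + rf.εP + rf.kapP + 4μΔ ≤ ρΔ`, floor) — the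
located content «Bałaban's rates and constants meet them» is NOT claimed here.

HONEST SCOPE.  Elementary real inequalities repackaging TYPED hypotheses of a landed junction; the `def`s are transparent numerals
(no structure, no instance, no notation, no new named fact, D-0026); nothing of Bałaban's operators, kernels or constants is
constructed or asserted; count-neutral; N10 NOT discharged; K1⁷ NOT closed; one finite four-torus programme at fixed ε per run; nothing
continuum ∕ ℝ⁴ ∕ OS ∕ mass-gap ∕ Clay.  No `sorry`.
-/

noncomputable section

namespace Literature.MathematicalPhysics.QuantumFieldTheory.Balaban1983to89.B13EntrywiseBlockNumerals

/-! ## §1. The two existential rates as numerals of the dials, and the seven rate binders one by one -/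

section Rates

variable (ρΔ ηΔ μΔ εP kapP : ℝ)

/-- NUMERAL (choice). The FAR RATE of the junction, `εΔ := epsOf ηΔ εP μΔ := ηΔ + εP + 2μΔ` — the least value the binders `hμε`, `hεP`
admit (decoration rate + the rung's far precision + two junction losses). [cite: Balaban1987RG1, (1.11) p.262; Balaban1988RG2Cluster, (2.16) p.16] -/
def epsOf (ηΔ εP μΔ : ℝ) : ℝ := ηΔ + εP + 2 * μΔ

/-- NUMERAL (choice). The EXCHANGE RATE of the junction, `κΔ := kapOf kapP μΔ := kapP + 2μΔ` — the least value the binders `hμκ`, `hkapP`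
admit (the rung's exchange precision + two junction losses). [cite: Balaban1988RG2Cluster, (2.16) p.16, (2.24) p.17] -/
def kapOf (kapP μΔ : ℝ) : ℝ := kapP + 2 * μΔ

variable {ρΔ ηΔ μΔ εP kapP}

/-- Binder `hηε` at the numerals: `ηΔ ≤ εΔ` (for `εP ≥ 0`, `μΔ ≥ 0`). [cite: Balaban1987RG1, (1.11) p.262] -/
theorem eta_le_epsOf (hεP : 0 ≤ εP) (hμ : 0 ≤ μΔ) : ηΔ ≤ epsOf ηΔ εP μΔ := by
  unfold epsOf; linarith

/-- Binder `hρε` at the numerals: `εΔ < ρΔ`, from the rate budget `ηΔ + εP + kapP + 4μΔ ≤ ρΔ` with `kapP ≥ 0`, `μΔ > 0`.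
[cite: Balaban1987RG1, (1.11) p.262; Balaban1988RG2Cluster, (2.16) p.16] -/
theorem epsOf_lt_rho (hkapP : 0 ≤ kapP) (hμ : 0 < μΔ) (hbudget : ηΔ + εP + kapP + 4 * μΔ ≤ ρΔ) : epsOf ηΔ εP μΔ < ρΔ := by
  unfold epsOf; linarith

/-- Binder `hμε` at the numerals: `2μΔ ≤ εΔ − ηΔ` (for `εP ≥ 0`). [cite: Balaban1988RG2Cluster, (2.16) p.16] -/
theorem two_mu_le_epsOf_sub (hεP : 0 ≤ εP) : 2 * μΔ ≤ epsOf ηΔ εP μΔ - ηΔ := by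
  unfold epsOf; linarith

/-- Binder `hμκ` at the numerals: `2μΔ ≤ κΔ` (for `kapP ≥ 0`). [cite: Balaban1988RG2Cluster, (2.16) p.16] -/
theorem two_mu_le_kapOf (hkapP : 0 ≤ kapP) : 2 * μΔ ≤ kapOf kapP μΔ := by
  unfold kapOf; linarith

/-- Binder `hκεΔ` at the numerals: `κΔ ≤ ρΔ − εΔ` — THIS is the rate budget `ηΔ + εP + kapP + 4μΔ ≤ ρΔ`.
[cite: Balaban1988RG2Cluster, (2.16) p.16, (2.24) p.17] -/
theorem kapOf_le_rho_sub_epsOf (hbudget : ηΔ + εP + kapP + 4 * μΔ ≤ ρΔ) : kapOf kapP μΔ ≤ ρΔ - epsOf ηΔ εP μΔ := by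
  unfold kapOf epsOf; linarith

/-- Binder `hεP` at the numerals, WITH EQUALITY: `εP ≤ εΔ − ηΔ − μΔ − μΔ`. [cite: Balaban1988RG2Cluster, (2.16) p.16] -/
theorem epsP_le_epsOf : εP ≤ epsOf ηΔ εP μΔ - ηΔ - μΔ - μΔ := by
  unfold epsOf; linarith

/-- Binder `hkapP` at the numerals, WITH EQUALITY: `kapP ≤ κΔ − μΔ − μΔ`. [cite: Balaban1988RG2Cluster, (2.16) p.16, (2.24) p.17] -/
theorem kapP_le_kapOf : kapP ≤ kapOf kapP μΔ - μΔ - μΔ := by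
  unfold kapOf; linarith

end Rates

/-! ## §2. ★ The seven rate binders ⟺ ONE rate budget (dials `ηΔ`, `μΔ` free) -/

section Budget

variable {ρΔ ηΔ μΔ εP kapP εΔ κΔ : ℝ}

/-- ★ **THE SEVEN RATE BINDERS FROM THE RATE BUDGET.**  For `0 ≤ εP`, `0 ≤ kapP`, `0 < μΔ` and `ηΔ + εP + kapP + 4μΔ ≤ ρΔ`, the numerals
`εΔ := epsOf ηΔ εP μΔ`, `κΔ := kapOf kapP μΔ` satisfy `hηε ∧ hρε ∧ hμε ∧ hμκ ∧ hκεΔ ∧ hεP ∧ hkapP` in the junction's exact shapes.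
[cite: Balaban1987RG1, (1.11) p.262; Balaban1988RG2Cluster, p.15, (2.16) p.16, (2.24) p.17] -/
theorem rates_of_budget (hεP : 0 ≤ εP) (hkapP : 0 ≤ kapP) (hμ : 0 < μΔ) (hbudget : ηΔ + εP + kapP + 4 * μΔ ≤ ρΔ) :
    ηΔ ≤ epsOf ηΔ εP μΔ ∧ epsOf ηΔ εP μΔ < ρΔ ∧
      2 * μΔ ≤ epsOf ηΔ εP μΔ - ηΔ ∧ 2 * μΔ ≤ kapOf kapP μΔ ∧ kapOf kapP μΔ ≤ ρΔ - epsOf ηΔ εP μΔ ∧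
      εP ≤ epsOf ηΔ εP μΔ - ηΔ - μΔ - μΔ ∧ kapP ≤ kapOf kapP μΔ - μΔ - μΔ :=
  ⟨eta_le_epsOf hεP hμ.le, epsOf_lt_rho hkapP hμ hbudget, two_mu_le_epsOf_sub hεP, two_mu_le_kapOf hkapP,
    kapOf_le_rho_sub_epsOf hbudget, epsP_le_epsOf, kapP_le_kapOf⟩

/-- The same as an existential statement over `εΔ κΔ` (the junction's implicit binders). [cite: Balaban1988RG2Cluster, (2.16) p.16, (2.24) p.17] -/
theorem exists_rates_of_budget (hεP : 0 ≤ εP) (hkapP : 0 ≤ kapP) (hμ : 0 < μΔ) (hbudget : ηΔ + εP + kapP + 4 * μΔ ≤ ρΔ) :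
    ∃ εΔ κΔ : ℝ, ηΔ ≤ εΔ ∧ εΔ < ρΔ ∧ 2 * μΔ ≤ εΔ - ηΔ ∧ 2 * μΔ ≤ κΔ ∧ κΔ ≤ ρΔ - εΔ ∧
      εP ≤ εΔ - ηΔ - μΔ - μΔ ∧ kapP ≤ κΔ - μΔ - μΔ :=
  ⟨epsOf ηΔ εP μΔ, kapOf kapP μΔ, rates_of_budget hεP hkapP hμ hbudget⟩

/-- ★ **CONVERSE: THE BUDGET IS NECESSARY.**  Any rates `εΔ κΔ` with `hμε`-free `hεP`, `hkapP`, `hκεΔ` already force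
`ηΔ + εP + kapP + 4μΔ ≤ ρΔ` — the reduction of §2 loses nothing. [cite: Balaban1988RG2Cluster, (2.16) p.16, (2.24) p.17] -/
theorem budget_of_rates (hκεΔ : κΔ ≤ ρΔ - εΔ) (hεP : εP ≤ εΔ - ηΔ - μΔ - μΔ) (hkapP : kapP ≤ κΔ - μΔ - μΔ) :
    ηΔ + εP + kapP + 4 * μΔ ≤ ρΔ := by
  linarith

/-- The budget is monotone: it persists when `εP`, `kapP`, `ηΔ`, `μΔ` decrease or `ρΔ` increases (the `_of_le` form a consumer with
weaker letters uses). [cite: Balaban1988RG2Cluster, (2.16) p.16] -/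
theorem budget_mono {ρΔ' ηΔ' μΔ' εP' kapP' : ℝ} (hbudget : ηΔ + εP + kapP + 4 * μΔ ≤ ρΔ) (hρ : ρΔ ≤ ρΔ') (hη : ηΔ' ≤ ηΔ)
    (hμ : μΔ' ≤ μΔ) (hε : εP' ≤ εP) (hκ : kapP' ≤ kapP) : ηΔ' + εP' + kapP' + 4 * μΔ' ≤ ρΔ' := by
  linarith

end Budget

/-! ## §3. The canonical dials: the least decoration rate and the junction loss exhausting the budget -/

section Dials

variable (ρΔ ηΔ εP kapP κ₁ M₁ : ℝ)

/-- NUMERAL (choice). The least DECORATION RATE the (1.11)-binder `hP2 : 2κ₁ ≤ ηΔ·M₁` admits: `ηΔ := etaOf κ₁ M₁ := 2κ₁∕M₁`.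
[cite: Balaban1987RG1, (1.11)–(1.14) p.262] -/
def etaOf (κ₁ M₁ : ℝ) : ℝ := 2 * κ₁ / M₁

/-- NUMERAL (choice). The JUNCTION LOSS exhausting the budget: `μΔ := muOf ρΔ ηΔ εP kapP := (ρΔ − ηΔ − εP − kapP)∕4`.
[cite: Balaban1988RG2Cluster, (2.16) p.16; Balaban1984PropagatorsII, Lemma 2.1 (2.61) p.234] -/
def muOf (ρΔ ηΔ εP kapP : ℝ) : ℝ := (ρΔ - ηΔ - εP - kapP) / 4

variable {ρΔ ηΔ εP kapP κ₁ M₁}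

/-- Binder `hηΔ` at the dial: `0 < etaOf κ₁ M₁` for `κ₁ > 0`, `M₁ > 0`. [cite: Balaban1987RG1, (1.11) p.262] -/
theorem etaOf_pos (hκ₁ : 0 < κ₁) (hM₁ : 0 < M₁) : 0 < etaOf κ₁ M₁ := by
  unfold etaOf; positivity

/-- Binder `hP2` at the dial, WITH EQUALITY: `2κ₁ ≤ etaOf κ₁ M₁ · M₁` (`M₁ > 0`). [cite: Balaban1987RG1, (1.11)–(1.14) p.262] -/
theorem hP2_etaOf (hM₁ : 0 < M₁) : 2 * κ₁ ≤ etaOf κ₁ M₁ * M₁ := by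
  unfold etaOf
  rw [div_mul_cancel₀ _ hM₁.ne']

/-- `etaOf κ₁ M₁ · M₁ = 2κ₁` (`M₁ ≠ 0`). [cite: Balaban1987RG1, (1.11) p.262] -/
theorem etaOf_mul (hM₁ : M₁ ≠ 0) : etaOf κ₁ M₁ * M₁ = 2 * κ₁ := by
  unfold etaOf
  rw [div_mul_cancel₀ _ hM₁]

/-- Any decoration rate the binder `hP2` admits is at least the dial: `2κ₁ ≤ ηΔ·M₁`, `M₁ > 0` ⟹ `etaOf κ₁ M₁ ≤ ηΔ`.
[cite: Balaban1987RG1, (1.11)–(1.14) p.262] -/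
theorem etaOf_le_of_hP2 (hM₁ : 0 < M₁) (hP2 : 2 * κ₁ ≤ ηΔ * M₁) : etaOf κ₁ M₁ ≤ ηΔ := by
  unfold etaOf
  rw [div_le_iff₀ hM₁]
  exact hP2

/-- Binder `hμΔ` at the dial: `0 < muOf ρΔ ηΔ εP kapP` iff the STRICT budget `ηΔ + εP + kapP < ρΔ`.
[cite: Balaban1988RG2Cluster, (2.16) p.16] -/
theorem muOf_pos_iff : 0 < muOf ρΔ ηΔ εP kapP ↔ ηΔ + εP + kapP < ρΔ := by
  unfold muOf
  constructor <;> intro h <;> linarith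

/-- `0 < muOf …` from the strict budget. [cite: Balaban1988RG2Cluster, (2.16) p.16] -/
theorem muOf_pos (h : ηΔ + εP + kapP < ρΔ) : 0 < muOf ρΔ ηΔ εP kapP :=
  muOf_pos_iff.2 h

/-- The dial EXHAUSTS the budget: `ηΔ + εP + kapP + 4·muOf … = ρΔ`. [cite: Balaban1988RG2Cluster, (2.16) p.16] -/
theorem budget_muOf_eq : ηΔ + εP + kapP + 4 * muOf ρΔ ηΔ εP kapP = ρΔ := by
  unfold muOf; ring

/-- The budget at the dial (the `≤` form the junction reads). [cite: Balaban1988RG2Cluster, (2.16) p.16] -/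
theorem budget_muOf : ηΔ + εP + kapP + 4 * muOf ρΔ ηΔ εP kapP ≤ ρΔ :=
  budget_muOf_eq.le

/-- The dial is the LARGEST junction loss the budget admits: `ηΔ + εP + kapP + 4μΔ ≤ ρΔ` ⟹ `μΔ ≤ muOf …`.
[cite: Balaban1988RG2Cluster, (2.16) p.16] -/
theorem le_muOf_of_budget {μΔ : ℝ} (hbudget : ηΔ + εP + kapP + 4 * μΔ ≤ ρΔ) : μΔ ≤ muOf ρΔ ηΔ εP kapP := by
  unfold muOf; linarith

end Dials

/-! ## §4. The constant floor: the left side of `hKP` as a numeral -/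

section Floor

variable (ν mF c₀ : ℕ) (ρΔ ηΔ μΔ rC κ₁ BΔ : ℝ)

/-- NUMERAL (verbatim shape). The junction's expansion constant — the LEFT SIDE OF `hKP` at the letters
`(ν, mF, c₀, ρΔ, ηΔ, μΔ, rC, κ₁, BΔ)`: `(mF·c₀(1,μΔ)^ν)·((mF·c₀(1,μΔ)^ν)·e^{(ρΔ−ηΔ)r_C}·(e^{κ₁·2c₀}·BΔ(mF²+1))·c₀(1,μΔ)^ν)·e^{(ρΔ−ηΔ−μΔ)r_C}·c₀(1,μΔ)^ν`
(two `C`-sandwich junctions and two decoration junctions, each paying [4]'s row-sum constant `c₀(1,μΔ)^ν`; the geodesic decoration pays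
`e^{2κ₁c₀}`, the averaging range pays `e^{(rate)·r_C}`). [cite: Balaban1984PropagatorsII, Lemma 2.1 (2.61) p.234; Balaban1988RG2Cluster, (2.24) p.17] -/
def kbarFloor (ν mF c₀ : ℕ) (ρΔ ηΔ μΔ rC κ₁ BΔ : ℝ) : ℝ :=
  (mF * B6.c0 1 μΔ ^ ν) * ((mF * B6.c0 1 μΔ ^ ν) * Real.exp ((ρΔ - ηΔ) * rC) *
      (Real.exp (κ₁ * (2 * c₀ : ℕ)) * (BΔ * (mF * mF + 1))) * B6.c0 1 μΔ ^ ν) *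
    Real.exp ((ρΔ - ηΔ - μΔ) * rC) * B6.c0 1 μΔ ^ ν

variable {ν mF c₀ ρΔ ηΔ μΔ rC κ₁ BΔ}

/-- `0 ≤ kbarFloor` for `BΔ ≥ 0`. [cite: Balaban1984PropagatorsII, Lemma 2.1 (2.61) p.234] -/
theorem kbarFloor_nonneg (hB : 0 ≤ BΔ) : 0 ≤ kbarFloor ν mF c₀ ρΔ ηΔ μΔ rC κ₁ BΔ := by
  unfold kbarFloor
  have hc : 0 ≤ B6.c0 1 μΔ ^ ν := pow_nonneg (B6RandomWalk.c0_nonneg 1 μΔ) ν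
  positivity

/-- Binder `hKP` in its exact shape from the located floor `kbarFloor … ≤ KbarP`. [cite: Balaban1984PropagatorsII, Lemma 2.1 (2.61) p.234;
Balaban1988RG2Cluster, (2.24) p.17] -/
theorem hKP_of_kbarFloor_le {KbarP : ℝ} (h : kbarFloor ν mF c₀ ρΔ ηΔ μΔ rC κ₁ BΔ ≤ KbarP) :
    (mF * B6.c0 1 μΔ ^ ν) * ((mF * B6.c0 1 μΔ ^ ν) * Real.exp ((ρΔ - ηΔ) * rC) *
        (Real.exp (κ₁ * (2 * c₀ : ℕ)) * (BΔ * (mF * mF + 1))) * B6.c0 1 μΔ ^ ν) *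
      Real.exp ((ρΔ - ηΔ - μΔ) * rC) * B6.c0 1 μΔ ^ ν ≤ KbarP :=
  h

/-- The floor is monotone in the entry constant `BΔ` (a consumer with a larger entry bound raises the floor).
[cite: Balaban1984PropagatorsII, Lemma 2.1 (2.61) p.234] -/
theorem kbarFloor_mono_B {BΔ' : ℝ} (hB : BΔ ≤ BΔ') : kbarFloor ν mF c₀ ρΔ ηΔ μΔ rC κ₁ BΔ ≤ kbarFloor ν mF c₀ ρΔ ηΔ μΔ rC κ₁ BΔ' := by
  unfold kbarFloor
  have hc : 0 ≤ B6.c0 1 μΔ ^ ν := pow_nonneg (B6RandomWalk.c0_nonneg 1 μΔ) ν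
  have hm : 0 ≤ (mF : ℝ) * B6.c0 1 μΔ ^ ν := mul_nonneg (Nat.cast_nonneg _) hc
  have h1 : BΔ * ((mF : ℝ) * mF + 1) ≤ BΔ' * ((mF : ℝ) * mF + 1) := mul_le_mul_of_nonneg_right hB (by positivity)
  have h2 : Real.exp (κ₁ * (2 * c₀ : ℕ)) * (BΔ * ((mF : ℝ) * mF + 1)) ≤ Real.exp (κ₁ * (2 * c₀ : ℕ)) * (BΔ' * ((mF : ℝ) * mF + 1)) :=
    mul_le_mul_of_nonneg_left h1 (Real.exp_pos _).le
  gcongr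

end Floor

/-! ## §5. ★★ The bundles: the ELEVEN binders of the NODE-A numerics from the budget and the floor -/

section Bundle

variable {ν mF c₀ : ℕ} {ρΔ ηΔ μΔ rC κ₁ BΔ M₁ εP kapP KbarP : ℝ}

/-- ★★ **DIAL FORM.**  For any decoration rate `ηΔ` with `0 < ηΔ`, `2κ₁ ≤ ηΔ·M₁`, any junction loss `0 < μΔ`, rung letters `0 ≤ εP`,
`0 ≤ kapP`, the rate budget `ηΔ + εP + kapP + 4μΔ ≤ ρΔ` and the floor `kbarFloor ν mF c₀ ρΔ ηΔ μΔ rC κ₁ BΔ ≤ KbarP`, THERE ARE rates `εΔ κΔ`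
such that ALL ELEVEN binders `hηΔ hηε hρε hP2 hμΔ hμε hμκ hκεΔ hεP hkapP hKP` of the entrywise junction hold in their exact shapes (listed in
the junction's order). [cite: Balaban1987RG1, (1.11)–(1.14) p.262; Balaban1988RG2Cluster, p.15, (2.16) p.16, (2.24) p.17;
Balaban1984PropagatorsII, Lemma 2.1 (2.61) p.234] -/
theorem numerals_nodeA_of_dials (hη : 0 < ηΔ) (hP2 : 2 * κ₁ ≤ ηΔ * M₁) (hμ : 0 < μΔ) (hεP : 0 ≤ εP) (hkapP : 0 ≤ kapP)
    (hbudget : ηΔ + εP + kapP + 4 * μΔ ≤ ρΔ) (hfloor : kbarFloor ν mF c₀ ρΔ ηΔ μΔ rC κ₁ BΔ ≤ KbarP) :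
    ∃ εΔ κΔ : ℝ,
      0 < ηΔ ∧ ηΔ ≤ εΔ ∧ εΔ < ρΔ ∧ 2 * κ₁ ≤ ηΔ * M₁ ∧
      0 < μΔ ∧ 2 * μΔ ≤ εΔ - ηΔ ∧ 2 * μΔ ≤ κΔ ∧ κΔ ≤ ρΔ - εΔ ∧
      εP ≤ εΔ - ηΔ - μΔ - μΔ ∧ kapP ≤ κΔ - μΔ - μΔ ∧
      (mF * B6.c0 1 μΔ ^ ν) * ((mF * B6.c0 1 μΔ ^ ν) * Real.exp ((ρΔ - ηΔ) * rC) *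
          (Real.exp (κ₁ * (2 * c₀ : ℕ)) * (BΔ * (mF * mF + 1))) * B6.c0 1 μΔ ^ ν) *
        Real.exp ((ρΔ - ηΔ - μΔ) * rC) * B6.c0 1 μΔ ^ ν ≤ KbarP := by
  obtain ⟨h1, h2, h3, h4, h5, h6, h7⟩ := rates_of_budget (ηΔ := ηΔ) (ρΔ := ρΔ) hεP hkapP hμ hbudget
  exact ⟨epsOf ηΔ εP μΔ, kapOf kapP μΔ, hη, h1, h2, hP2, hμ, h3, h4, h5, h6, h7, hKP_of_kbarFloor_le hfloor⟩

/-- ★★ **CANONICAL FORM.**  For `0 < κ₁`, `0 < M₁`, rung letters `0 ≤ εP`, `0 ≤ kapP`, the STRICT rate budget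
`etaOf κ₁ M₁ + εP + kapP < ρΔ` (i.e. `2κ₁∕M₁ + εP + kapP < ρΔ`) and the floor at the canonical dials
`kbarFloor ν mF c₀ ρΔ (etaOf κ₁ M₁) (muOf ρΔ (etaOf κ₁ M₁) εP kapP) rC κ₁ BΔ ≤ KbarP`, THERE ARE `ηΔ εΔ κΔ μΔ` such that ALL ELEVEN binders
`hηΔ hηε hρε hP2 hμΔ hμε hμκ hκεΔ hεP hkapP hKP` hold in their exact shapes. [cite: Balaban1987RG1, (1.11)–(1.14) p.262; Balaban1988RG2Cluster,
p.15, (2.16) p.16, (2.24) p.17, p.21; Balaban1984PropagatorsII, Lemma 2.1 (2.61) p.234] -/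
theorem numerals_nodeA (hκ₁ : 0 < κ₁) (hM₁ : 0 < M₁) (hεP : 0 ≤ εP) (hkapP : 0 ≤ kapP)
    (hbudget : etaOf κ₁ M₁ + εP + kapP < ρΔ)
    (hfloor : kbarFloor ν mF c₀ ρΔ (etaOf κ₁ M₁) (muOf ρΔ (etaOf κ₁ M₁) εP kapP) rC κ₁ BΔ ≤ KbarP) :
    ∃ ηΔ εΔ κΔ μΔ : ℝ,
      0 < ηΔ ∧ ηΔ ≤ εΔ ∧ εΔ < ρΔ ∧ 2 * κ₁ ≤ ηΔ * M₁ ∧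
      0 < μΔ ∧ 2 * μΔ ≤ εΔ - ηΔ ∧ 2 * μΔ ≤ κΔ ∧ κΔ ≤ ρΔ - εΔ ∧
      εP ≤ εΔ - ηΔ - μΔ - μΔ ∧ kapP ≤ κΔ - μΔ - μΔ ∧
      (mF * B6.c0 1 μΔ ^ ν) * ((mF * B6.c0 1 μΔ ^ ν) * Real.exp ((ρΔ - ηΔ) * rC) *
          (Real.exp (κ₁ * (2 * c₀ : ℕ)) * (BΔ * (mF * mF + 1))) * B6.c0 1 μΔ ^ ν) *
        Real.exp ((ρΔ - ηΔ - μΔ) * rC) * B6.c0 1 μΔ ^ ν ≤ KbarP := by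
  obtain ⟨εΔ, κΔ, h⟩ := numerals_nodeA_of_dials (etaOf_pos hκ₁ hM₁) (hP2_etaOf hM₁) (muOf_pos hbudget) hεP hkapP budget_muOf hfloor
  exact ⟨etaOf κ₁ M₁, εΔ, κΔ, muOf ρΔ (etaOf κ₁ M₁) εP kapP, h⟩

/-- The strict budget is monotone in the letters (a consumer with a larger decay rate `ρΔ' ≥ ρΔ` or smaller `εP' kapP' κ₁'` or larger `M₁'`
keeps it). [cite: Balaban1988RG2Cluster, (2.16) p.16] -/
theorem strictBudget_mono {ρΔ' εP' kapP' : ℝ} (h : etaOf κ₁ M₁ + εP + kapP < ρΔ) (hρ : ρΔ ≤ ρΔ') (hε : εP' ≤ εP) (hκ : kapP' ≤ kapP) :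
    etaOf κ₁ M₁ + εP' + kapP' < ρΔ' := by
  linarith

end Bundle

/-! ## §6. NON-VACUITY (A6): the located conditions are jointly inhabited, with room -/

section Witness

/-- The canonical form's located conditions are jointly inhabited: `κ₁ = M₁ = εP = kapP = 1`, `ρΔ = 5` (so `ηΔ = 2`, `μΔ = ¼ > 0`), and
`KbarP :=` the floor itself — for ANY `ν mF c₀ rC BΔ`. [cite: Balaban1988RG2Cluster, (2.24) p.17 (bookkeeping, not the paper's constants)] -/
theorem exists_letters (ν mF c₀ : ℕ) (rC BΔ : ℝ) :
    ∃ κ₁ M₁ εP kapP ρΔ KbarP : ℝ, 0 < κ₁ ∧ 0 < M₁ ∧ 0 ≤ εP ∧ 0 ≤ kapP ∧ etaOf κ₁ M₁ + εP + kapP < ρΔ ∧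
      kbarFloor ν mF c₀ ρΔ (etaOf κ₁ M₁) (muOf ρΔ (etaOf κ₁ M₁) εP kapP) rC κ₁ BΔ ≤ KbarP := by
  refine ⟨1, 1, 1, 1, 5, kbarFloor ν mF c₀ 5 (etaOf 1 1) (muOf 5 (etaOf 1 1) 1 1) rC 1 BΔ, one_pos, one_pos, zero_le_one, zero_le_one,
    ?_, le_rfl⟩
  unfold etaOf; norm_num

/-- … hence the ELEVEN binders themselves are jointly inhabited through `numerals_nodeA` (sanity: the bundle fires).
[cite: Balaban1988RG2Cluster, (2.24) p.17 (bookkeeping)] -/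
theorem exists_binders (ν mF c₀ : ℕ) (rC BΔ : ℝ) :
    ∃ κ₁ M₁ εP kapP ρΔ KbarP ηΔ εΔ κΔ μΔ : ℝ,
      0 < ηΔ ∧ ηΔ ≤ εΔ ∧ εΔ < ρΔ ∧ 2 * κ₁ ≤ ηΔ * M₁ ∧
      0 < μΔ ∧ 2 * μΔ ≤ εΔ - ηΔ ∧ 2 * μΔ ≤ κΔ ∧ κΔ ≤ ρΔ - εΔ ∧
      εP ≤ εΔ - ηΔ - μΔ - μΔ ∧ kapP ≤ κΔ - μΔ - μΔ ∧
      (mF * B6.c0 1 μΔ ^ ν) * ((mF * B6.c0 1 μΔ ^ ν) * Real.exp ((ρΔ - ηΔ) * rC) *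
          (Real.exp (κ₁ * (2 * c₀ : ℕ)) * (BΔ * (mF * mF + 1))) * B6.c0 1 μΔ ^ ν) *
        Real.exp ((ρΔ - ηΔ - μΔ) * rC) * B6.c0 1 μΔ ^ ν ≤ KbarP := by
  obtain ⟨κ₁, M₁, εP, kapP, ρΔ, KbarP, hκ, hM, hε, hk, hb, hf⟩ := exists_letters ν mF c₀ rC BΔ
  obtain ⟨ηΔ, εΔ, κΔ, μΔ, h⟩ := numerals_nodeA hκ hM hε hk hb hf
  exact ⟨κ₁, M₁, εP, kapP, ρΔ, KbarP, ηΔ, εΔ, κΔ, μΔ, h⟩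

end Witness

end Literature.MathematicalPhysics.QuantumFieldTheory.Balaban1983to89.B13EntrywiseBlockNumerals

end
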